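import Literature.MathematicalPhysics.KineticTheory.VelocityAverageKernel
import Literature.Analysis.FunctionSpaces.BesovSliceMeasurability
import HarnessLib

/-!
# Equicontinuity of translates of velocity averages (`TT*`), hence compactness

Topic: MathematicalPhysics / KineticTheory. Fifth file of the Fourier-free proof of the `L¹`
velocity-averaging lemma (CIP 1994 Lemma 5.3.9; see the header of `VelocityAverageOperator`).
From the adjoint identity (`integral_avgDuhamel_mul_eq`) and the kernel representation
`A A* = κ ∗` (`avgDuhamel_adjAvgDuhamel_eq`) one gets, for `ρ = A F` and a space-time translation
`h`, with `ρ_h = ρ(· - h) - ρ = A(F_h)` (`F_h` the translated-minus-original source) and any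
`λ > 0`,

  `‖ρ_h‖₂² = ⟨F_h, A* ρ_h⟩ ≤ (λ/2) ‖F_h‖₂² + (2λ)⁻¹ ‖A* ρ_h‖₂²`,
  `‖A* ρ_h‖₂² = ⟨κ ∗ ρ_h, ρ_h⟩ = ∫∫ (κ(q - h) - κ(q)) ρ(p - q) (ρ(p - h) - ρ(p)) dq dp`
  `           ≤ 2 (∫ |κ(q - h) - κ(q)| dq) ‖ρ‖₂²`,

so that `‖ρ_h‖₂² ≤ 2 λ B² V + M(h) K / λ` with `M(h) = ∫ |κ(q - h) - κ(q)| dq → 0` as `h → 0`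
(continuity of translation in `L¹`, `Literature.Analysis.FunctionSpaces.continuous_eLpNorm_comp_add_sub`) and constants
depending only on the sup bound `B`, the support radius and `ψ₀, S`: the translates of the
velocity averages `A F` are **equicontinuous in `L²`, uniformly over `L^∞`-bounded sources with
common compact support** (`avgDuhamel_translate_modulus`). Together with the common compact
support of the `A F` (`avgDuhamel_eq_zero_of_norm_gt`) this is exactly the hypothesis of the
Kolmogorov–Riesz criterion (`Literature.Analysis.FunctionSpaces.exists_finset_eLpNorm_sub_lt_of_translate`), which replaces
"bounded in `H^{1/2}`, i.e. compact in `L²`" (CIP 1994, p. 155, via Lemma 5.3.8 and Rellich) in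
the proof of Lemma 5.3.9. Everything is proved.

## References

* C. Cercignani, R. Illner, M. Pulvirenti, *The Mathematical Theory of Dilute Gases*, Springer
  (1994), §5.3, proof of Lemma 5.3.9, p. 155. [CIPDiluteGases1994]
* L. Saint-Raymond, *Hydrodynamic Limits of the Boltzmann Equation*, LNM 1971 (2009), §3.3.2–3.3.3
  (dispersion and `L¹` averaging). [SaintRaymond2009]
-/

noncomputable section

open MeasureTheory Set Filter Function Metric Module
open _root_.Topology
open scoped ENNReal NNReal

namespace Literature.MathematicalPhysics.KineticTheory

/-! ## Elementary `L²` bookkeeping for bounded functions with bounded support -/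

section L2

variable {X : Type*} [MeasurableSpace X] {μ : Measure X}

/-- `∫ f² ≤ C² μ(s)` if `|f| ≤ C` and `f` vanishes off `s`. [folklore] -/
theorem integral_sq_le_of_bounded {f : X → ℝ} {C : ℝ} (hC : ∀ x, |f x| ≤ C) {s : Set X}
    (hμs : μ s < ⊤) (h0 : ∀ x, x ∉ s → f x = 0) :
    ∫ x, f x ^ 2 ∂μ ≤ C ^ 2 * (μ s).toReal := by
  rw [← setIntegral_eq_integral_of_forall_compl_eq_zero (s := s) (fun x hx => by
    rw [h0 x hx]; ring)]
  have h := norm_setIntegral_le_of_norm_le_const (μ := μ) (s := s) (f := fun x => f x ^ 2)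
    (C := C ^ 2) hμs fun x _ => by
      rw [Real.norm_eq_abs, abs_of_nonneg (sq_nonneg _), ← sq_abs]
      exact pow_le_pow_left₀ (abs_nonneg _) (hC x) 2
  rw [Real.norm_eq_abs, abs_of_nonneg (integral_nonneg fun x => sq_nonneg _)] at h
  exact h

/-- The square of a bounded integrable function is integrable. [folklore] -/
theorem integrable_sq_of_bounded {f : X → ℝ} (hf : Integrable f μ) {C : ℝ} (hC : ∀ x, |f x| ≤ C) :
    Integrable (fun x => f x ^ 2) μ := by
  have h := hf.abs.mul_bdd hf.abs.aestronglyMeasurable (ae_of_all _ fun x =>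
    (Real.norm_eq_abs _).le.trans ((abs_abs (f x)).le.trans (hC x)))
  refine h.congr (ae_of_all _ fun x => ?_)
  dsimp only
  rw [← abs_mul, abs_mul_self, sq]

/-- **Weighted AM–GM under the integral**: `∫ f g ≤ (λ/2) ∫ f² + (2λ)⁻¹ ∫ g²` (`λ > 0`). [folklore] -/
theorem integral_mul_le_am_gm {f g : X → ℝ} (hfg : Integrable (fun x => f x * g x) μ)
    (hf2 : Integrable (fun x => f x ^ 2) μ) (hg2 : Integrable (fun x => g x ^ 2) μ)
    {lam : ℝ} (hlam : 0 < lam) :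
    ∫ x, f x * g x ∂μ ≤ lam / 2 * ∫ x, f x ^ 2 ∂μ + 1 / (2 * lam) * ∫ x, g x ^ 2 ∂μ := by
  rw [← MeasureTheory.integral_const_mul, ← MeasureTheory.integral_const_mul,
    ← integral_add (hf2.const_mul _) (hg2.const_mul _)]
  refine integral_mono hfg ((hf2.const_mul _).add (hg2.const_mul _)) fun x => ?_
  have h : 0 ≤ (lam * f x - g x) ^ 2 / (2 * lam) := by positivity
  have e : lam / 2 * f x ^ 2 + 1 / (2 * lam) * g x ^ 2 - f x * g x =
      (lam * f x - g x) ^ 2 / (2 * lam) := by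
    field_simp
    ring
  simp only
  linarith

/-- `|a| |b| ≤ (a² + b²)/2`. [folklore] -/
theorem abs_mul_abs_le_add_sq (a b : ℝ) : |a| * |b| ≤ (a ^ 2 + b ^ 2) / 2 := by
  nlinarith [sq_nonneg (|a| - |b|), sq_abs a, sq_abs b, abs_nonneg a, abs_nonneg b]

end L2

section Translates

variable {V : Type*} [NormedAddCommGroup V] [MeasurableSpace V] [BorelSpace V]
  [SecondCountableTopology V] {μ : Measure V} [μ.IsAddRightInvariant]

omit [SecondCountableTopology V] in
/-- **Cross terms of translates**: `∫ |ρ(p - a)| |ρ(p - b)| ≤ ∫ ρ²` for bounded integrable `ρ`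
(AM–GM and translation invariance). [folklore] -/
theorem integral_abs_translate_mul_le {ρ : V → ℝ} (hρ : Integrable ρ μ) {C : ℝ}
    (hC : ∀ p, |ρ p| ≤ C) (a b : V) :
    ∫ p, |ρ (p - a)| * |ρ (p - b)| ∂μ ≤ ∫ p, ρ p ^ 2 ∂μ := by
  have h2 : Integrable (fun p => ρ p ^ 2) μ := integrable_sq_of_bounded hρ hC
  have hta : Integrable (fun p => ρ (p - a) ^ 2) μ := h2.comp_sub_right a
  have htb : Integrable (fun p => ρ (p - b) ^ 2) μ := h2.comp_sub_right b
  have hab : Integrable (fun p => |ρ (p - a)| * |ρ (p - b)|) μ :=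
    (hρ.comp_sub_right a).abs.mul_bdd (hρ.comp_sub_right b).abs.aestronglyMeasurable
      (c := C) (ae_of_all _ fun p => by rw [Real.norm_eq_abs, abs_abs]; exact hC _)
  calc ∫ p, |ρ (p - a)| * |ρ (p - b)| ∂μ ≤ ∫ p, (ρ (p - a) ^ 2 + ρ (p - b) ^ 2) / 2 ∂μ :=
        integral_mono hab ((hta.add htb).div_const 2) fun p => abs_mul_abs_le_add_sq _ _
    _ = ((∫ p, ρ (p - a) ^ 2 ∂μ) + ∫ p, ρ (p - b) ^ 2 ∂μ) / 2 := by
        rw [MeasureTheory.integral_div, integral_add hta htb]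
    _ = ∫ p, ρ p ^ 2 ∂μ := by
        rw [integral_sub_right_eq_self (fun p => ρ p ^ 2) a,
          integral_sub_right_eq_self (fun p => ρ p ^ 2) b]
        ring

/-- **Moving a translation from the function to the kernel**: for integrable `κ` and bounded
measurable `ρ`, `∫ κ(q) (ρ(p - q - h) - ρ(p - q)) dq = ∫ (κ(q - h) - κ(q)) ρ(p - q) dq`. [folklore] -/
theorem integral_kernel_mul_translate_sub {κ ρ : V → ℝ} (hκ : Integrable κ μ) (hρm : Measurable ρ)
    {C : ℝ} (hC : ∀ p, |ρ p| ≤ C) (p h : V) :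
    ∫ q, κ q * (ρ (p - q - h) - ρ (p - q)) ∂μ = ∫ q, (κ (q - h) - κ q) * ρ (p - q) ∂μ := by
  have hC' : ∀ x, ‖ρ x‖ ≤ C := fun x => (Real.norm_eq_abs _).le.trans (hC x)
  have hi : ∀ (k : V → ℝ), Integrable k μ → ∀ a : V, Integrable (fun q => k q * ρ (a - q)) μ :=
    fun k hk a => hk.mul_bdd (hρm.comp (measurable_const.sub measurable_id)).aestronglyMeasurable
      (ae_of_all _ fun q => hC' _)
  have h1 : ∫ q, κ q * ρ (p - q - h) ∂μ = ∫ q, κ (q - h) * ρ (p - q) ∂μ := by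
    have e := integral_sub_right_eq_self (μ := μ) (fun q => κ q * ρ (p - h - q)) h
    have e1 : (fun q => κ q * ρ (p - q - h)) = fun q => κ q * ρ (p - h - q) := by
      funext q; rw [sub_right_comm]
    have e2 : (fun q => κ (q - h) * ρ (p - h - (q - h))) = fun q => κ (q - h) * ρ (p - q) := by
      funext q; congr 2; abel
    rw [e1, ← e, e2]
  calc ∫ q, κ q * (ρ (p - q - h) - ρ (p - q)) ∂μ
      = ∫ q, (κ q * ρ (p - q - h) - κ q * ρ (p - q)) ∂μ := by simp_rw [mul_sub]
    _ = (∫ q, κ q * ρ (p - q - h) ∂μ) - ∫ q, κ q * ρ (p - q) ∂μ := by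
        refine integral_sub ?_ (hi κ hκ p)
        have := hi κ hκ (p - h)
        refine this.congr (ae_of_all _ fun q => ?_)
        simp only [sub_right_comm p h q]
    _ = (∫ q, κ (q - h) * ρ (p - q) ∂μ) - ∫ q, κ q * ρ (p - q) ∂μ := by rw [h1]
    _ = ∫ q, (κ (q - h) * ρ (p - q) - κ q * ρ (p - q)) ∂μ :=
        (integral_sub (hi _ (hκ.comp_sub_right h) p) (hi κ hκ p)).symm
    _ = ∫ q, (κ (q - h) - κ q) * ρ (p - q) ∂μ := by simp_rw [sub_mul]

/-- **The pairing bound**: for integrable `k`, bounded measurable integrable `ρ`, and measurable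
`G` with `|G| ≤ |ρ(· - h)| + |ρ|`,
`|∫ (∫ k(q) ρ(p - q) dq) G(p) dp| ≤ 2 ‖k‖₁ ‖ρ‖₂²` (Fubini, AM–GM, translation invariance). [folklore] -/
theorem abs_integral_kernel_pairing_le [SFinite μ] {k ρ G : V → ℝ} (hk : Integrable k μ)
    (hkm : Measurable k) (hρ : Integrable ρ μ) (hρm : Measurable ρ) {C : ℝ} (hC : ∀ p, |ρ p| ≤ C)
    (hGi : Integrable G μ) (hGm : Measurable G) (h : V) (hG : ∀ p, |G p| ≤ |ρ (p - h)| + |ρ p|) :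
    |∫ p, (∫ q, k q * ρ (p - q) ∂μ) * G p ∂μ| ≤ 2 * (∫ q, |k q| ∂μ) * ∫ p, ρ p ^ 2 ∂μ := by
  have hC0 : 0 ≤ C := (abs_nonneg _).trans (hC 0)
  have hC' : ∀ x, ‖ρ x‖ ≤ C := fun x => (Real.norm_eq_abs _).le.trans (hC x)
  -- the product integrand and its integrability
  set Φ : V × V → ℝ := fun z => k z.2 * ρ (z.1 - z.2) * G z.1 with hΦ
  have hΦm : Measurable Φ :=
    ((hkm.comp measurable_snd).mul (hρm.comp (measurable_fst.sub measurable_snd))).mul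
      (hGm.comp measurable_fst)
  have hΦi : Integrable Φ (μ.prod μ) := by
    refine ((hGi.norm.mul_prod hk.norm).const_mul C).mono' hΦm.aestronglyMeasurable
      (ae_of_all _ fun z => ?_)
    rw [hΦ]; simp only [norm_mul, Real.norm_eq_abs]
    calc |k z.2| * |ρ (z.1 - z.2)| * |G z.1| ≤ |k z.2| * C * |G z.1| := by
          gcongr; exact hC _
      _ = C * (‖G z.1‖ * ‖k z.2‖) := by rw [Real.norm_eq_abs, Real.norm_eq_abs]; ring
  -- Fubini
  have e1 : ∫ p, (∫ q, k q * ρ (p - q) ∂μ) * G p ∂μ = ∫ p, ∫ q, Φ (p, q) ∂μ ∂μ := by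
    refine integral_congr_ae (ae_of_all _ fun p => ?_)
    dsimp only
    rw [← MeasureTheory.integral_mul_const]
  rw [e1, integral_integral_swap hΦi]
  -- pointwise bound of the inner `p`-integral
  have hin : ∀ q, |∫ p, Φ (p, q) ∂μ| ≤ |k q| * (2 * ∫ p, ρ p ^ 2 ∂μ) := by
    intro q
    have hb1 := integral_abs_translate_mul_le hρ hC q h
    have hb2 := integral_abs_translate_mul_le hρ hC q 0
    simp only [sub_zero] at hb2
    have hi1 : Integrable (fun p => |ρ (p - q)| * |ρ (p - h)|) μ :=
      (hρ.comp_sub_right q).abs.mul_bdd (hρ.comp_sub_right h).abs.aestronglyMeasurable (c := C)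
        (ae_of_all _ fun p => by rw [Real.norm_eq_abs, abs_abs]; exact hC _)
    have hi2 : Integrable (fun p => |ρ (p - q)| * |ρ p|) μ :=
      (hρ.comp_sub_right q).abs.mul_bdd hρ.abs.aestronglyMeasurable (c := C)
        (ae_of_all _ fun p => by rw [Real.norm_eq_abs, abs_abs]; exact hC _)
    calc |∫ p, Φ (p, q) ∂μ| ≤ ∫ p, |Φ (p, q)| ∂μ := abs_integral_le_integral_abs
      _ ≤ ∫ p, |k q| * (|ρ (p - q)| * |ρ (p - h)| + |ρ (p - q)| * |ρ p|) ∂μ := by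
          refine integral_mono_of_nonneg (ae_of_all _ fun p => abs_nonneg _)
            ((hi1.add hi2).const_mul _) (ae_of_all _ fun p => ?_)
          rw [hΦ]; simp only [abs_mul]
          rw [mul_assoc]
          refine mul_le_mul_of_nonneg_left ?_ (abs_nonneg _)
          rw [← mul_add]
          exact mul_le_mul_of_nonneg_left (hG p) (abs_nonneg _)
      _ = |k q| * ((∫ p, |ρ (p - q)| * |ρ (p - h)| ∂μ) + ∫ p, |ρ (p - q)| * |ρ p| ∂μ) := by
          rw [MeasureTheory.integral_const_mul, integral_add hi1 hi2]
      _ ≤ |k q| * (2 * ∫ p, ρ p ^ 2 ∂μ) := by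
          refine mul_le_mul_of_nonneg_left ?_ (abs_nonneg _)
          linarith
  calc |∫ q, ∫ p, Φ (p, q) ∂μ ∂μ| ≤ ∫ q, |∫ p, Φ (p, q) ∂μ| ∂μ := abs_integral_le_integral_abs
    _ ≤ ∫ q, |k q| * (2 * ∫ p, ρ p ^ 2 ∂μ) ∂μ :=
        integral_mono_of_nonneg (ae_of_all _ fun q => abs_nonneg _) (hk.abs.mul_const _)
          (ae_of_all _ hin)
    _ = 2 * (∫ q, |k q| ∂μ) * ∫ p, ρ p ^ 2 ∂μ := by
        rw [MeasureTheory.integral_mul_const]; ring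

end Translates

variable {E : Type*} [NormedAddCommGroup E] [InnerProductSpace ℝ E] [FiniteDimensional ℝ E]
  [MeasurableSpace E] [BorelSpace E]

/-! ## The `TT*` estimate -/

section TTStar

variable {ψ₀ : E → ℝ} {Cψ r S : ℝ}

/-- The `L¹` modulus of the `TT*` kernel under translation by `h`:
`M(h) = ∫ |κ(q - h) - κ(q)| dq`. [folklore] -/
def ttKernelModulus (ψ₀ : E → ℝ) (S : ℝ) (h : ℝ × E) : ℝ :=
  ∫ q, |ttKernel ψ₀ S (q - h) - ttKernel ψ₀ S q|

/-- Unfolding of `ttKernelModulus`. [folklore] -/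
theorem ttKernelModulus_apply (ψ₀ : E → ℝ) (S : ℝ) (h : ℝ × E) :
    ttKernelModulus ψ₀ S h = ∫ q, |ttKernel ψ₀ S (q - h) - ttKernel ψ₀ S q| := rfl

/-- `0 ≤ M(h)`. [folklore] -/
theorem ttKernelModulus_nonneg (ψ₀ : E → ℝ) (S : ℝ) (h : ℝ × E) : 0 ≤ ttKernelModulus ψ₀ S h :=
  integral_nonneg fun _ => abs_nonneg _

/-- **`M(h) → 0` as `h → 0`** (continuity of translation in `L¹`, for the integrable kernel `κ`). [folklore] -/
theorem tendsto_ttKernelModulus (hψm : Measurable ψ₀) (hψb : ∀ ξ, |ψ₀ ξ| ≤ Cψ)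
    (hψr : ∀ ξ, r < ‖ξ‖ → ψ₀ ξ = 0) (hS : 0 ≤ S) :
    Tendsto (ttKernelModulus ψ₀ S) (𝓝 0) (𝓝 0) := by
  set κ : ℝ × E → ℝ := ttKernel ψ₀ S with hκ
  have hκi : Integrable κ volume := integrable_ttKernel hψm hψb hψr hS
  haveI : (volume : Measure (ℝ × E)).IsAddRightInvariant := Measure.prod.instIsAddRightInvariant
  have hc : Continuous fun h : ℝ × E => eLpNorm (fun x => κ (x + h) - κ x) 1 volume :=
    Literature.Analysis.FunctionSpaces.continuous_eLpNorm_comp_add_sub le_rfl ENNReal.one_ne_top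
      (memLp_one_iff_integrable.2 hκi)
  have h0 : ((fun h : ℝ × E => eLpNorm (fun x => κ (x + h) - κ x) 1 volume) ∘ fun a => -a) 0 = 0 := by
    simp
  have ht := (hc.comp continuous_neg).tendsto 0
  rw [h0] at ht
  have ht' := (ENNReal.tendsto_toReal ENNReal.zero_ne_top).comp ht
  rw [ENNReal.toReal_zero] at ht'
  refine ht'.congr fun h => ?_
  have hm : AEStronglyMeasurable (fun x => κ (x + -h) - κ x) volume :=
    ((hκi.comp_sub_right h).sub hκi).1.congr (ae_of_all _ fun x => by simp [sub_eq_add_neg])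
  simp only [Function.comp_apply]
  rw [ttKernelModulus_apply, eLpNorm_one_eq_lintegral_enorm, ← integral_norm_eq_lintegral_enorm hm]
  refine integral_congr_ae (ae_of_all _ fun q => ?_)
  simp only [Real.norm_eq_abs, hκ, sub_eq_add_neg]

/-- **The `TT*` estimate.** Let `ψ₀` be measurable with `|ψ₀| ≤ Cψ`, supported in the ball of
radius `r`, `0 ≤ S`, and let `F` be measurable with `|F| ≤ B`, supported in the ball of radius `R`
of `ℝ × E × E`. Then for every space-time translation `h` with `‖h‖ ≤ 1` and every `λ > 0`, the
velocity average `ρ = A F = avgDuhamel ψ₀ S F` satisfies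
`∫ (ρ(p - h) - ρ(p))² dp ≤ 2 λ B² V + M(h) K / λ`, where `V = |B̄(0, R + 1)|` (phase space-time),
`K = C_A² |B̄(0, R + S + S R)|` (space-time) with `C_A = (∫ |ψ₀|) S B`, and
`M(h) = ∫ |κ(q - h) - κ(q)| dq` (`ttKernelModulus`). Proof: `ρ(· - h) - ρ = A(F_h)` with
`F_h = F(· - h) - F` (`avgDuhamel_translate`, `avgDuhamel_sub`); by the adjoint identity and
AM–GM, `‖A F_h‖₂² = ⟨F_h, A*(A F_h)⟩ ≤ (λ/2)‖F_h‖₂² + (2λ)⁻¹‖A* ρ_h‖₂²`; again by the adjoint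
identity and `A A* = κ ∗` (`avgDuhamel_adjAvgDuhamel_eq`),
`‖A* ρ_h‖₂² = ⟨κ ∗ ρ_h, ρ_h⟩ = ⟨(κ(· - h) - κ) ∗ ρ, ρ_h⟩ ≤ 2 M(h) ‖ρ‖₂²`
(`integral_kernel_mul_translate_sub`, `abs_integral_kernel_pairing_le`). This is the real-space
(`TT*`) substitute for "bounded in `H^{1/2}`, i.e. compact in `L²`" in CIP 1994, p. 155. [cite: CIPDiluteGases1994, §5.3 proof of Lemma 5.3.9, p. 155] -/
theorem integral_sq_translate_avgDuhamel_sub_le (hψm : Measurable ψ₀) (hψb : ∀ ξ, |ψ₀ ξ| ≤ Cψ)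
    (hr : 0 ≤ r) (hψr : ∀ ξ, r < ‖ξ‖ → ψ₀ ξ = 0) (hS : 0 ≤ S)
    {F : ℝ × E × E → ℝ} (hFm : Measurable F) {B R : ℝ} (hFb : ∀ z, |F z| ≤ B) (hR : 0 ≤ R)
    (hFR : ∀ z, R < ‖z‖ → F z = 0) {h : ℝ × E} (hh : ‖h‖ ≤ 1) {lam : ℝ} (hlam : 0 < lam) :
    ∫ p, (avgDuhamel ψ₀ S F (p - h) - avgDuhamel ψ₀ S F p) ^ 2 ≤
      2 * lam * (B ^ 2 * (volume (closedBall (0 : ℝ × E × E) (R + 1))).toReal) +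
        ttKernelModulus ψ₀ S h * (((∫ ξ, |ψ₀ ξ|) * (S * B)) ^ 2 *
          (volume (closedBall (0 : ℝ × E) (R + S + S * R))).toReal) / lam := by
  haveI : (volume : Measure (ℝ × E)).IsAddRightInvariant := Measure.prod.instIsAddRightInvariant
  have hB : 0 ≤ B := (abs_nonneg _).trans (hFb 0)
  have hCψ : 0 ≤ Cψ := (abs_nonneg _).trans (hψb 0)
  ---- `ψ₀` is integrable
  have hψi : Integrable ψ₀ volume :=
    integrable_of_bounded_of_eq_zero hψm.aestronglyMeasurable hψb
      (isCompact_closedBall (0 : E) r).measure_lt_top fun ξ hξ => hψr ξ (by simpa using hξ)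
  ---- the velocity average `ρ` and its translate difference `G`
  set ρ : ℝ × E → ℝ := avgDuhamel ψ₀ S F with hρ_def
  set CA : ℝ := (∫ ξ, |ψ₀ ξ|) * (S * B) with hCA
  set R₁ : ℝ := R + S + S * R with hR₁
  have hR₁0 : 0 ≤ R₁ := by positivity
  have hρm : Measurable ρ := (stronglyMeasurable_avgDuhamel hψm hFm).measurable
  have hρb : ∀ p, |ρ p| ≤ CA := fun p => abs_avgDuhamel_le hψi hS hFb p
  have hCA0 : 0 ≤ CA := (abs_nonneg _).trans (hρb 0)
  have hρ0 : ∀ p, R₁ < ‖p‖ → ρ p = 0 := fun p hp => avgDuhamel_eq_zero_of_norm_gt hR hFR hS hp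
  have hρi : Integrable ρ volume :=
    integrable_of_bounded_of_eq_zero hρm.aestronglyMeasurable hρb
      (isCompact_closedBall (0 : ℝ × E) R₁).measure_lt_top fun p hp => hρ0 p (by simpa using hp)
  set G : ℝ × E → ℝ := fun p => ρ (p - h) - ρ p with hG_def
  have hGm : Measurable G := (hρm.comp (measurable_id.sub measurable_const)).sub hρm
  have hGb : ∀ p, |G p| ≤ 2 * CA := fun p => by
    rw [hG_def]; simp only
    calc |ρ (p - h) - ρ p| ≤ |ρ (p - h)| + |ρ p| := abs_sub _ _
      _ ≤ CA + CA := add_le_add (hρb _) (hρb _)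
      _ = 2 * CA := by ring
  have hGb' : ∀ p, |G p| ≤ |ρ (p - h)| + |ρ p| := fun p => abs_sub _ _
  have hG0 : ∀ p, R₁ + 1 < ‖p‖ → G p = 0 := fun p hp => by
    rw [hG_def]; simp only
    rw [hρ0 p (by linarith), hρ0 (p - h) ?_, sub_zero]
    have : ‖p‖ ≤ ‖p - h‖ + ‖h‖ := norm_le_norm_sub_add p h
    linarith
  have hGi : Integrable G volume :=
    integrable_of_bounded_of_eq_zero hGm.aestronglyMeasurable hGb
      (isCompact_closedBall (0 : ℝ × E) (R₁ + 1)).measure_lt_top fun p hp => hG0 p (by simpa using hp)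
  ---- the translated source difference `D`, with `A D = G`
  set D : ℝ × E × E → ℝ := fun z => F (z.1 - h.1, z.2.1 - h.2, z.2.2) - F z with hD_def
  have hDm : Measurable D := (hFm.comp (by fun_prop)).sub hFm
  have hDb : ∀ z, |D z| ≤ 2 * B := fun z => by
    rw [hD_def]; simp only
    calc |F (z.1 - h.1, z.2.1 - h.2, z.2.2) - F z| ≤ |F (z.1 - h.1, z.2.1 - h.2, z.2.2)| + |F z| :=
          abs_sub _ _
      _ ≤ B + B := add_le_add (hFb _) (hFb _)
      _ = 2 * B := by ring
  have hD0 : ∀ z, R + 1 < ‖z‖ → D z = 0 := fun z hz => by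
    rw [hD_def]; simp only
    rw [hFR z (by linarith), hFR _ ?_, sub_zero]
    have h1 : ‖z‖ ≤ ‖((z.1 - h.1, z.2.1 - h.2, z.2.2) : ℝ × E × E)‖ + ‖h‖ := by
      have e : z = ((z.1 - h.1, z.2.1 - h.2, z.2.2) : ℝ × E × E) + ((h.1, h.2, (0 : E)) : ℝ × E × E) := by
        ext <;> simp
      have hn : ‖((h.1, h.2, (0 : E)) : ℝ × E × E)‖ = ‖h‖ := by
        simp [Prod.norm_def]
      calc ‖z‖ = ‖((z.1 - h.1, z.2.1 - h.2, z.2.2) : ℝ × E × E) + ((h.1, h.2, (0 : E)) : ℝ × E × E)‖ := by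
            rw [← e]
        _ ≤ _ := norm_add_le _ _
        _ = _ := by rw [hn]
    linarith
  have hτm : Measurable fun z : ℝ × E × E => F (z.1 - h.1, z.2.1 - h.2, z.2.2) :=
    hFm.comp (by fun_prop)
  have hAD : ∀ p, avgDuhamel ψ₀ S D p = G p := fun p => by
    rw [hD_def, avgDuhamel_sub hψm hψb hψr (F₁ := fun z => F (z.1 - h.1, z.2.1 - h.2, z.2.2))
      hτm hFm (B := B) (fun z => hFb _) hFb, avgDuhamel_translate]
  ---- Step 1: `∫ G² = ∫ D · A* G`
  have hR1' : 0 ≤ R + 1 := by linarith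
  have e1 : ∫ p, G p ^ 2 = ∫ z, D z * adjAvgDuhamel ψ₀ S G z := by
    rw [← integral_avgDuhamel_mul_eq hψm hψb hS hDm hDb hR1' hD0 hGm hGb]
    refine integral_congr_ae (ae_of_all _ fun p => ?_)
    dsimp only
    rw [hAD, sq]
  ---- Step 2: AM–GM
  set AG : ℝ × E × E → ℝ := adjAvgDuhamel ψ₀ S G with hAG
  have hAGm : Measurable AG := (stronglyMeasurable_adjAvgDuhamel hψm hGm).measurable
  have hAGb : ∀ z, |AG z| ≤ Cψ * (S * (2 * CA)) := fun z => abs_adjAvgDuhamel_le hψb hS hGb z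
  have hR2 : 0 ≤ R₁ + 1 := by linarith
  have hAG0 : ∀ z, (R₁ + 1) + S + S * r + r < ‖z‖ → AG z = 0 := fun z hz =>
    adjAvgDuhamel_eq_zero_of_norm_gt hr hψr hR2 hG0 hS hz
  have hAGi : Integrable AG volume :=
    integrable_of_bounded_of_eq_zero hAGm.aestronglyMeasurable hAGb
      (isCompact_closedBall (0 : ℝ × E × E) ((R₁ + 1) + S + S * r + r)).measure_lt_top
      fun z hz => hAG0 z (by simpa using hz)
  have hDi : Integrable D volume :=
    integrable_of_bounded_of_eq_zero hDm.aestronglyMeasurable hDb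
      (isCompact_closedBall (0 : ℝ × E × E) (R + 1)).measure_lt_top fun z hz => hD0 z (by simpa using hz)
  have hDAG : Integrable (fun z => D z * AG z) volume :=
    hDi.mul_bdd hAGm.aestronglyMeasurable (ae_of_all _ fun z =>
      (Real.norm_eq_abs _).le.trans (hAGb z))
  have e2 : ∫ z, D z * AG z ≤ lam / 2 * (∫ z, D z ^ 2) + 1 / (2 * lam) * ∫ z, AG z ^ 2 :=
    integral_mul_le_am_gm hDAG (integrable_sq_of_bounded hDi hDb) (integrable_sq_of_bounded hAGi hAGb)
      hlam
  ---- Step 3: `∫ D² ≤ 4 B² V`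
  have e3 : ∫ z, D z ^ 2 ≤ (2 * B) ^ 2 * (volume (closedBall (0 : ℝ × E × E) (R + 1))).toReal :=
    integral_sq_le_of_bounded hDb (isCompact_closedBall _ _).measure_lt_top
      fun z hz => hD0 z (by simpa using hz)
  ---- Step 4: `∫ (A*G)² = ∫ (κ' ∗ ρ) G` with `κ' = κ(· - h) - κ`
  have hκi : Integrable (ttKernel ψ₀ S) volume := integrable_ttKernel hψm hψb hψr hS
  have hκm : Measurable (ttKernel ψ₀ S) := measurable_ttKernel hψm S
  have e4 : ∫ z, AG z ^ 2 =
      ∫ p, (∫ q, (ttKernel ψ₀ S (q - h) - ttKernel ψ₀ S q) * ρ (p - q)) * G p := by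
    have hR3 : 0 ≤ (R₁ + 1) + S + S * r + r := by positivity
    have h41 : ∫ z, AG z ^ 2 = ∫ p, avgDuhamel ψ₀ S AG p * G p := by
      rw [integral_avgDuhamel_mul_eq hψm hψb hS hAGm hAGb hR3 hAG0 hGm hGb]
      refine integral_congr_ae (ae_of_all _ fun z => ?_)
      dsimp only
      rw [sq, hAG]
    rw [h41]
    refine integral_congr_ae (ae_of_all _ fun p => ?_)
    dsimp only
    congr 1
    rw [hAG, avgDuhamel_adjAvgDuhamel_eq hψm hψb hψr hS hGm hGb p,
      ← integral_kernel_mul_translate_sub hκi hρm hρb p h]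
  ---- Step 5: the pairing bound
  have e5 : |∫ p, (∫ q, (ttKernel ψ₀ S (q - h) - ttKernel ψ₀ S q) * ρ (p - q)) * G p| ≤
      2 * ttKernelModulus ψ₀ S h * ∫ p, ρ p ^ 2 := by
    have h51 := abs_integral_kernel_pairing_le
      (k := fun q => ttKernel ψ₀ S (q - h) - ttKernel ψ₀ S q) ((hκi.comp_sub_right h).sub hκi)
      ((hκm.comp (measurable_id.sub measurable_const)).sub hκm) hρi hρm hρb hGi hGm h hGb'
    rwa [← ttKernelModulus_apply] at h51
  have e6 : ∫ p, ρ p ^ 2 ≤ CA ^ 2 * (volume (closedBall (0 : ℝ × E) R₁)).toReal :=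
    integral_sq_le_of_bounded hρb (isCompact_closedBall _ _).measure_lt_top
      fun p hp => hρ0 p (by simpa using hp)
  ---- assemble
  have hM0 : 0 ≤ ttKernelModulus ψ₀ S h := ttKernelModulus_nonneg _ _ _
  have e7 : ∫ z, AG z ^ 2 ≤ 2 * ttKernelModulus ψ₀ S h *
      (CA ^ 2 * (volume (closedBall (0 : ℝ × E) R₁)).toReal) := by
    rw [e4]
    refine (le_abs_self _).trans (e5.trans ?_)
    exact mul_le_mul_of_nonneg_left e6 (by positivity)
  have eG : ∫ p, (avgDuhamel ψ₀ S F (p - h) - avgDuhamel ψ₀ S F p) ^ 2 = ∫ p, G p ^ 2 := rfl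
  rw [eG, e1]
  calc ∫ z, D z * AG z ≤ lam / 2 * (∫ z, D z ^ 2) + 1 / (2 * lam) * ∫ z, AG z ^ 2 := e2
    _ ≤ lam / 2 * ((2 * B) ^ 2 * (volume (closedBall (0 : ℝ × E × E) (R + 1))).toReal) +
        1 / (2 * lam) * (2 * ttKernelModulus ψ₀ S h *
          (CA ^ 2 * (volume (closedBall (0 : ℝ × E) R₁)).toReal)) := by
        gcongr
    _ = _ := by
        rw [hCA, hR₁]
        field_simp

end TTStar

/-! ## Equicontinuity of translates in `L²` -/

section Modulus

variable {ψ₀ : E → ℝ} {Cψ r S : ℝ}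

omit [FiniteDimensional ℝ E] [MeasurableSpace E] [BorelSpace E] [InnerProductSpace ℝ E]
  [NormedAddCommGroup E] in
/-- From `∫ G² ≤ ε²` to `‖G‖_{L²} ≤ ε`. [folklore] -/
theorem eLpNorm_two_le_of_integral_sq_le {X : Type*} [MeasurableSpace X] {μ : Measure X}
    {G : X → ℝ} (h2 : Integrable (fun x => G x ^ 2) μ) {ε : ℝ} (hε : 0 ≤ ε)
    (h : ∫ x, G x ^ 2 ∂μ ≤ ε ^ 2) : eLpNorm G 2 μ ≤ ENNReal.ofReal ε := by
  rw [eLpNorm_eq_lintegral_rpow_enorm_toReal two_ne_zero ENNReal.ofNat_ne_top]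
  have e1 : ∀ x, ‖G x‖ₑ ^ (2 : ℝ≥0∞).toReal = ENNReal.ofReal (G x ^ 2) := fun x => by
    rw [ENNReal.toReal_ofNat, Real.enorm_eq_ofReal_abs, ENNReal.ofReal_rpow_of_nonneg (abs_nonneg _)
      (by norm_num), Real.rpow_two, sq_abs]
  simp_rw [e1]
  rw [← ofReal_integral_eq_lintegral_ofReal h2 (ae_of_all _ fun x => sq_nonneg _),
    ENNReal.toReal_ofNat]
  calc (ENNReal.ofReal (∫ x, G x ^ 2 ∂μ)) ^ (1 / (2 : ℝ))
      ≤ (ENNReal.ofReal (ε ^ 2)) ^ (1 / (2 : ℝ)) := ENNReal.rpow_le_rpow (ENNReal.ofReal_le_ofReal h) (by norm_num)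
    _ = ENNReal.ofReal ε := by
        rw [ENNReal.ofReal_pow hε, ← ENNReal.rpow_natCast, ← ENNReal.rpow_mul]
        norm_num

/-- **Equicontinuity of translates of velocity averages in `L²`** (the hypothesis of the
Kolmogorov–Riesz criterion, `Literature.Analysis.FunctionSpaces.exists_finset_eLpNorm_sub_lt_of_translate`). For `ψ₀`
measurable, bounded and compactly supported, `0 ≤ S`, `0 ≤ R`: for every `ε > 0` there is
`δ > 0` such that for **every** measurable source `F` with `|F| ≤ B` supported in the ball of
radius `R`, and every space-time translation `‖h‖ ≤ δ`,
`‖(A F)(· - h) - A F‖_{L²(ℝ × E)} ≤ ε` (`A = avgDuhamel ψ₀ S`). This replaces, in the proof of CIP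
1994 Lemma 5.3.9 (p. 155), the `H^{1/2}` bound of Lemma 5.3.8 plus Rellich's theorem by the `TT*`
estimate `integral_sq_translate_avgDuhamel_sub_le` and the continuity of translation of the
`TT*` kernel in `L¹` (`tendsto_ttKernelModulus`). [cite: CIPDiluteGases1994, §5.3 proof of Lemma 5.3.9, p. 155] -/
theorem avgDuhamel_translate_modulus (hψm : Measurable ψ₀) (hψb : ∀ ξ, |ψ₀ ξ| ≤ Cψ) (hr : 0 ≤ r)
    (hψr : ∀ ξ, r < ‖ξ‖ → ψ₀ ξ = 0) (hS : 0 ≤ S) (B : ℝ) {R : ℝ} (hR : 0 ≤ R) {ε : ℝ}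
    (hε : 0 < ε) :
    ∃ δ : ℝ, 0 < δ ∧ ∀ F : ℝ × E × E → ℝ, Measurable F → (∀ z, |F z| ≤ B) →
      (∀ z, R < ‖z‖ → F z = 0) → ∀ h : ℝ × E, ‖h‖ ≤ δ →
        eLpNorm (fun p => avgDuhamel ψ₀ S F (p - h) - avgDuhamel ψ₀ S F p) 2 volume ≤
          ENNReal.ofReal ε := by
  -- the constants of the `TT*` estimate
  set V₁ : ℝ := (volume (closedBall (0 : ℝ × E × E) (R + 1))).toReal with hV₁
  set K : ℝ := ((∫ ξ, |ψ₀ ξ|) * (S * B)) ^ 2 *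
    (volume (closedBall (0 : ℝ × E) (R + S + S * R))).toReal with hK
  have hV₁0 : 0 ≤ V₁ := ENNReal.toReal_nonneg
  have hK0 : 0 ≤ K := mul_nonneg (sq_nonneg _) ENNReal.toReal_nonneg
  -- choose `λ` and then `δ`
  set lam : ℝ := ε ^ 2 / (4 * (B ^ 2 * V₁) + 4) with hlam
  have hlam0 : 0 < lam := by positivity
  have h1 : 2 * lam * (B ^ 2 * V₁) ≤ ε ^ 2 / 2 := by
    have hW : 0 ≤ B ^ 2 * V₁ := mul_nonneg (sq_nonneg B) hV₁0
    have : 2 * (B ^ 2 * V₁) / (4 * (B ^ 2 * V₁) + 4) ≤ 1 / 2 := by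
      rw [div_le_iff₀ (by positivity)]
      nlinarith
    calc 2 * lam * (B ^ 2 * V₁) = ε ^ 2 * (2 * (B ^ 2 * V₁) / (4 * (B ^ 2 * V₁) + 4)) := by
          rw [hlam]; ring
      _ ≤ ε ^ 2 * (1 / 2) := mul_le_mul_of_nonneg_left this (sq_nonneg _)
      _ = ε ^ 2 / 2 := by ring
  set η : ℝ := ε ^ 2 * lam / (2 * K + 2) with hη
  have hη0 : 0 < η := by positivity
  have hM := tendsto_ttKernelModulus hψm hψb hψr hS
  rw [Metric.tendsto_nhds] at hM
  obtain ⟨δ₀, hδ₀, hδ₀M⟩ := Metric.eventually_nhds_iff.1 (hM η hη0)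
  refine ⟨min (δ₀ / 2) 1, lt_min (half_pos hδ₀) one_pos, fun F hFm hFb hFR h hh => ?_⟩
  have hh1 : ‖h‖ ≤ 1 := hh.trans (min_le_right _ _)
  have hhδ : dist h 0 < δ₀ := by
    rw [dist_zero_right]; exact lt_of_le_of_lt (hh.trans (min_le_left _ _)) (half_lt_self hδ₀)
  have hMh : ttKernelModulus ψ₀ S h < η := by
    have := hδ₀M hhδ
    rw [dist_zero_right, Real.norm_of_nonneg (ttKernelModulus_nonneg _ _ _)] at this
    exact this
  -- the `TT*` estimate
  have hest := integral_sq_translate_avgDuhamel_sub_le hψm hψb hr hψr hS hFm hFb hR hFR hh1 hlam0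
  have h2 : ttKernelModulus ψ₀ S h * K / lam ≤ ε ^ 2 / 2 := by
    rw [div_le_iff₀ hlam0]
    calc ttKernelModulus ψ₀ S h * K ≤ η * K :=
          mul_le_mul_of_nonneg_right hMh.le hK0
      _ = ε ^ 2 * lam * (K / (2 * K + 2)) := by rw [hη]; ring
      _ ≤ ε ^ 2 * lam * (1 / 2) := by
          refine mul_le_mul_of_nonneg_left ?_ (by positivity)
          rw [div_le_iff₀ (by positivity)]
          linarith
      _ = ε ^ 2 / 2 * lam := by ring
  have hsq : ∫ p, (avgDuhamel ψ₀ S F (p - h) - avgDuhamel ψ₀ S F p) ^ 2 ≤ ε ^ 2 := by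
    have := hest.trans (add_le_add h1 h2)
    linarith
  -- integrability of the square of the difference
  have hψi : Integrable ψ₀ volume :=
    integrable_of_bounded_of_eq_zero hψm.aestronglyMeasurable hψb
      (isCompact_closedBall (0 : E) r).measure_lt_top fun ξ hξ => hψr ξ (by simpa using hξ)
  set ρ : ℝ × E → ℝ := avgDuhamel ψ₀ S F with hρ_def
  have hρm : Measurable ρ := (stronglyMeasurable_avgDuhamel hψm hFm).measurable
  have hρb : ∀ p, |ρ p| ≤ (∫ ξ, |ψ₀ ξ|) * (S * B) := fun p => abs_avgDuhamel_le hψi hS hFb p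
  have hρ0 : ∀ p, R + S + S * R < ‖p‖ → ρ p = 0 := fun p hp =>
    avgDuhamel_eq_zero_of_norm_gt hR hFR hS hp
  have hGm : Measurable fun p => ρ (p - h) - ρ p :=
    (hρm.comp (measurable_id.sub measurable_const)).sub hρm
  have hGb : ∀ p, |ρ (p - h) - ρ p| ≤ 2 * ((∫ ξ, |ψ₀ ξ|) * (S * B)) := fun p =>
    calc |ρ (p - h) - ρ p| ≤ |ρ (p - h)| + |ρ p| := abs_sub _ _
      _ ≤ _ := by linarith [hρb (p - h), hρb p]
  have hG0 : ∀ p, p ∉ closedBall (0 : ℝ × E) (R + S + S * R + 1) → ρ (p - h) - ρ p = 0 := by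
    intro p hp
    rw [mem_closedBall_zero_iff, not_le] at hp
    rw [hρ0 p (by linarith), hρ0 (p - h) ?_, sub_zero]
    have : ‖p‖ ≤ ‖p - h‖ + ‖h‖ := norm_le_norm_sub_add p h
    linarith
  have hGi : Integrable (fun p => ρ (p - h) - ρ p) volume :=
    integrable_of_bounded_of_eq_zero hGm.aestronglyMeasurable hGb
      (isCompact_closedBall (0 : ℝ × E) _).measure_lt_top hG0
  exact eLpNorm_two_le_of_integral_sq_le (integrable_sq_of_bounded hGi hGb) hε.le hsq

end Modulus

end Literature.MathematicalPhysics.KineticTheory
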